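import Summits.QuantumFields.YangMills.Theorems.AlphaInputsT3ACv3StartPlaqWindow
import HarnessLib

/-!
# `AlphaInputsT3ACv3StartPlaqChart` — MAP #3 M22, the (FL) `hLift` clause for `16 ≤ L^k`: **THE PLAQUETTE CHART** — for a constrained finest plaquette `q = (z; μ, ν)` of a region `Ω`
# SATURATED at level `k`, the comb gauge from the centre of ANY of the three blocks `blk z`, `blk(z+e_μ)`, `blk(z+e_ν)` is `(d⌊L^k∕2⌋ + 2L^k)·δ`-FLAT on EACH of the four bonds of `q`
# whenever the constrained plaquettes of `Ω` are within `δ` of `1` — including the 2×2 CORNER case (`z` on the far `μ`- and `ν`-faces of its block: corners in four blocks), which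
# no two-cell product set charts.  The chart is the per-plaquette WINDOW product set `I_κ = {start_κ + u : u ≤ W_κ}`, `W_κ = 2L^k − 1` in a straddled direction `κ ∈ {μ, ν}` and
# `L^k − 1` otherwise: every site of `∏ I_κ` lies over the block of one of the four corners (so in `Ω`), and the comb fans from the three centres to the four bonds stay in `∏ I_κ`
# (★w1 g0's `dist1_gaugeActT_axialT_le_of_box`) — lane `pub-balaban3d` ∕ cell `ym3-torus`, seat `ym-ust-19936-w4` (g3); ★w4 g3 LOCATED 04:54Z (the row `hflatP` of
# `hLift_clause_of_start`: (H)'s `hU₀P` and the kernel certificate's (δ) at the centre-anchored comb gauges)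

WHAT (def-free).  §§1–3 (window arithmetic, corner offsets, ★ `mem_of_window`) are the sibling module `…StartPlaqWindow`; here §4 ★★ `norm_gaugeAct_axialT_sub_one_le_of_plaqsIn`
(the row `hflatP` of `hLift_clause_of_start`).
HONEST FRAMING.  Torus-label bookkeeping over ★w5 g2's two-cell charts and ★w1 g0's regional axial gauge; count-neutral helper toward R3 2′ (items 19936∕19935); `hLift`, the stub 2′χ,
the crux `HistoryTailL` and any gap are NOT claimed; registry untouched; nothing about d = 4, the continuum, or a mass gap; YM₃ on T³ is rung R3, not Clay.

References: T. Bałaban, Commun. Math. Phys. 98 (1985) 17–51 [Balaban1985Averaging] ((8) p.18, (19) p.21, pp.24–25); CMP 109 (1987) 249–301 [Balaban1987RG1] ((0.1) p.251);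
CMP 102 (1985) 277–309 [Balaban1985Variational] ((3) p.278, (18) p.280).
-/

set_option autoImplicit false

noncomputable section

open scoped Matrix.Norms.L2Operator

namespace Summit.QuantumFields.YangMills.Theorems.TubeStart

open Literature.MathematicalPhysics.QuantumFieldTheory.Balaban1983to89
open T4Continuum
open B10Eq27TorusAxialLog (axialT gaugeActT rel rel_apply gaugeActT_eq_gaugeAct)
open B7Prop1Explicit (l1 e e_apply)
open Literature.MathematicalPhysics.QuantumFieldTheory.Balaban1983to89.B5Eq118OneStroke (iterBlockOf val_iterBlockOf)
open Literature.MathematicalPhysics.QuantumFieldTheory.Balaban1983to89.B10Eq38TorusDomains (toFine plaqsIn cornerSet mem_plaqsIn_iff)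
open Summit.QuantumFields.YangMills.Theorems.StartDefectBox (blockStart toFine_src_eq_blockStart toFine_tgt_apply)
open Summit.QuantumFields.YangMills.Theorems.RegionAxialGauge (dist1_gaugeActT_axialT_le_of_box)
open Summit.QuantumFields.YangMills.Theorems.PerturbedPlaquette (dist1_SU_eq)

/-! ## §4 The row `hflatP`: flatness of the comb gauges of the three blocks on the four bonds of a constrained plaquette -/

section Flat

variable {P : Params} {k : ℕ} {n : Type*} [Fintype n] [DecidableEq n] [Nonempty n]

/-- **★★ THE PLAQUETTE CHART ROW `hflatP`** (`k ≤ m + K`, `4L^k ≤ sitesPerDir 0`, Ω saturated at level `k`): if every constrained finest plaquette of `Ω` is within `δ ≥ 0` of `1`, then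
for every constrained plaquette `q = (z; μ, ν)`, every centre `y ∈ {blk z, blk(z+e_μ), blk(z+e_ν)}` and every bond `b` of `q`, the comb gauge `σ_y = axialT U (toFine k y)` has
`‖(U^{σ_y})_b − 1‖ ≤ (d⌊L^k∕2⌋ + 2L^k)·δ` — the comb fan from `ŷ` to `b` stays in the plaquette's window product set (§3), whose plaquettes are constrained, and has at most
`d⌊L^k∕2⌋ + 2L^k` bonds. [cite: Balaban1985Averaging, (8) p.18, pp.24–25; Balaban1985Variational, (18) p.280] -/
theorem norm_gaugeAct_axialT_sub_one_le_of_plaqsIn (hk : k ≤ P.m + P.K) (hN4 : 4 * P.L ^ k ≤ P.sitesPerDir 0) {Ω : Set (Site P 0)}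
    (hsat : ∀ x : Site P 0, x ∈ Ω ↔ toFine k (iterBlockOf k x) ∈ Ω) (U : GaugeField P 0 (Matrix.specialUnitaryGroup n ℂ)) {δ : ℝ} (hδ : 0 ≤ δ)
    (hU : ∀ q : Plaq P 0, q ∈ plaqsIn 0 Ω → GaugeGroup.dist1 (GaugeField.plaqHol U q) ≤ δ) (q : Plaq P 0) (hq : q ∈ plaqsIn 0 Ω)
    (y : Site P k) (hy : y = iterBlockOf k q.src ∨ y = iterBlockOf k (q.src.shift q.μ) ∨ y = iterBlockOf k (q.src.shift q.ν))
    (b : PBond P 0) (hb : b = ⟨q.src, q.μ⟩ ∨ b = ⟨q.src.shift q.μ, q.ν⟩ ∨ b = ⟨q.src.shift q.ν, q.μ⟩ ∨ b = ⟨q.src, q.ν⟩) :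
    ‖((GaugeField.gaugeAct (axialT U (toFine k y)) U b : Matrix.specialUnitaryGroup n ℂ) : Matrix n n ℂ) - 1‖ ≤ ((P.d * (P.L ^ k / 2) + 2 * P.L ^ k : ℕ) : ℝ) * δ := by
  classical
  have hpos : 0 < P.L ^ k := pow_pos P.L_pos k
  have h2 : P.L ^ k = 2 * (P.L ^ k / 2) + 1 := TubeStart.pow_eq_two_mul_half_add_one (P := P) k
  have hμν : q.μ ≠ q.ν := ne_of_lt q.hμν
  -- letters: start, offsets, windows
  set z : Site P 0 := q.src with hz
  set c0 : PBond P k := ⟨iterBlockOf k z, q.μ⟩ with hc0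
  set s : Fin P.d → ZMod (P.sitesPerDir 0) := fun κ => blockStart k c0 κ with hs
  set r : Fin P.d → ℕ := fun κ => (z κ).val % P.L ^ k with hr
  set W : Fin P.d → ℕ := fun κ => if (κ = q.μ ∨ κ = q.ν) ∧ r κ = P.L ^ k - 1 then 2 * P.L ^ k - 1 else P.L ^ k - 1 with hW
  have hrlt : ∀ κ, r κ < P.L ^ k := fun κ => Nat.mod_lt _ hpos
  have hWle : ∀ κ, W κ ≤ 2 * P.L ^ k - 1 := fun κ => by simp only [hW]; split_ifs <;> omega
  have hWge : ∀ κ, P.L ^ k - 1 ≤ W κ := fun κ => by simp only [hW]; split_ifs <;> omega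
  let I : Fin P.d → Set (ZMod (P.sitesPerDir 0)) := fun κ => {w | ∃ u : ℕ, u ≤ W κ ∧ w = s κ + ((u : ℕ) : ZMod (P.sitesPerDir 0))}
  -- §3: the plaquettes of the window product set are constrained
  have hmem : ∀ w : Site P 0, w ∈ {w : Site P 0 | ∀ κ, w κ ∈ I κ} → w ∈ Ω := fun w hw => mem_of_window hk hsat q hq w hw
  have hmid : ∀ (q' : Plaq P 0), q'.src ∈ {w : Site P 0 | ∀ κ, w κ ∈ I κ} → (q'.src.shift q'.μ).shift q'.ν ∈ {w : Site P 0 | ∀ κ, w κ ∈ I κ} →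
      (q'.src.shift q'.μ) ∈ {w : Site P 0 | ∀ κ, w κ ∈ I κ} ∧ (q'.src.shift q'.ν) ∈ {w : Site P 0 | ∀ κ, w κ ∈ I κ} := by
    intro q' ha hb
    have hμν' : q'.μ ≠ q'.ν := ne_of_lt q'.hμν
    constructor
    · intro κ
      by_cases hκ : κ = q'.μ
      · subst hκ
        have : (q'.src.shift q'.μ) q'.μ = ((q'.src.shift q'.μ).shift q'.ν) q'.μ := by rw [StartDefectBox.shift_shift_apply_left q'.src hμν']; simp [Site.shift]
        rw [this]; exact hb q'.μ
      · have : (q'.src.shift q'.μ) κ = q'.src κ := B10StarCount.shift_apply_ne _ hκ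
        rw [this]; exact ha κ
    · intro κ
      by_cases hκ : κ = q'.ν
      · subst hκ
        have : (q'.src.shift q'.ν) q'.ν = ((q'.src.shift q'.μ).shift q'.ν) q'.ν := by rw [StartDefectBox.shift_shift_apply_right q'.src hμν']; simp [Site.shift]
        rw [this]; exact hb q'.ν
      · have : (q'.src.shift q'.ν) κ = q'.src κ := B10StarCount.shift_apply_ne _ hκ
        rw [this]; exact ha κ
  have hWin : ∀ q' : Plaq P 0, q'.src ∈ {w : Site P 0 | ∀ κ, w κ ∈ I κ} → (q'.src.shift q'.μ).shift q'.ν ∈ {w : Site P 0 | ∀ κ, w κ ∈ I κ} →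
      GaugeGroup.dist1 (GaugeField.plaqHol U q') ≤ δ := by
    intro q' ha hb
    obtain ⟨hm1, hm2⟩ := hmid q' ha hb
    refine hU q' (mem_plaqsIn_iff.2 ?_)
    simp only [cornerSet, Set.insert_subset_iff, Set.singleton_subset_iff, B10Eq38TorusDomains.toFine_zero]
    exact ⟨hmem _ ha, hmem _ hm1, hmem _ hm2, hmem _ hb⟩
  -- the base: `ŷ_κ = s_κ + p_κ`, `p_κ = h + i_κ·L^k`, `i_κ = 1` only in a straddled plaquette direction
  have hbase : ∃ p : Fin P.d → ℕ, (∀ κ, p κ ≤ W κ) ∧ (∀ κ, P.L ^ k / 2 ≤ p κ) ∧ (∀ κ, p κ ≤ P.L ^ k / 2 + (if κ = q.μ ∨ κ = q.ν then P.L ^ k else 0)) ∧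
      ∀ κ, toFine k y κ = s κ + ((p κ : ℕ) : ZMod (P.sitesPerDir 0)) := by
    -- the block of a shifted corner: `blk(z+e_λ) = blk z` or `(blk z) + e_λ` with a straddle
    have hshift : ∀ lam : Fin P.d, (lam = q.μ ∨ lam = q.ν) →
        (iterBlockOf k (z.shift lam) = iterBlockOf k z) ∨ (iterBlockOf k (z.shift lam) = (⟨iterBlockOf k z, lam⟩ : PBond P k).tgt ∧ r lam = P.L ^ k - 1) := by
      intro lam hlam
      have hco : ∀ κ, iterBlockOf k (z.shift lam) κ = iterBlockOf k z κ + ((((r κ + (if κ = lam then 1 else 0)) / P.L ^ k : ℕ) : ℕ) : ZMod (P.sitesPerDir k)) :=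
        fun κ => iterBlockOf_apply_of_offset' hk z _ q.μ κ (shift_apply_eq_blockStart_add hk z q.μ lam κ)
      by_cases hstr : r lam = P.L ^ k - 1
      · right
        refine ⟨funext fun κ => ?_, hstr⟩
        rw [hco κ, div_offset_eq _ _ (hrlt κ) (by split_ifs <;> omega)]
        by_cases hκ : κ = lam
        · subst hκ; rw [if_pos ⟨if_pos rfl, hstr⟩]; simp [PBond.tgt, Site.shift]
        · rw [if_neg (by rw [if_neg hκ]; omega)]; simp [PBond.tgt, Site.shift, hκ]
      · left
        funext κ
        rw [hco κ, div_offset_eq _ _ (hrlt κ) (by split_ifs <;> omega)]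
        by_cases hκ : κ = lam
        · subst hκ; rw [if_neg (by rw [if_pos rfl]; exact fun h => hstr h.2)]; simp
        · rw [if_neg (by rw [if_neg hκ]; omega)]; simp
    -- the centre of `blk z` and of `blk z + e_λ`
    have hsrc : ∀ κ, toFine k (iterBlockOf k z) κ = s κ + (((P.L ^ k / 2 : ℕ) : ℕ) : ZMod (P.sitesPerDir 0)) := fun κ => toFine_src_eq_blockStart hk c0 κ
    have htgt : ∀ lam κ, toFine k (⟨iterBlockOf k z, lam⟩ : PBond P k).tgt κ = s κ + ((((P.L ^ k / 2 + (if κ = lam then P.L ^ k else 0)) : ℕ) : ℕ) : ZMod (P.sitesPerDir 0)) := by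
      intro lam κ
      have h1 := toFine_tgt_apply hk (⟨iterBlockOf k z, lam⟩ : PBond P k) κ
      have h2 : toFine k (⟨iterBlockOf k z, lam⟩ : PBond P k).src κ = s κ + (((P.L ^ k / 2 : ℕ) : ℕ) : ZMod (P.sitesPerDir 0)) := toFine_src_eq_blockStart hk c0 κ
      rw [h1, h2]
      push_cast
      ring
    have base0 : y = iterBlockOf k z → ∃ p : Fin P.d → ℕ, (∀ κ, p κ ≤ W κ) ∧ (∀ κ, P.L ^ k / 2 ≤ p κ) ∧
        (∀ κ, p κ ≤ P.L ^ k / 2 + (if κ = q.μ ∨ κ = q.ν then P.L ^ k else 0)) ∧ ∀ κ, toFine k y κ = s κ + ((p κ : ℕ) : ZMod (P.sitesPerDir 0)) := by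
      intro e
      refine ⟨fun _ => P.L ^ k / 2, fun κ => ?_, fun κ => le_rfl, fun κ => ?_, fun κ => ?_⟩
      · dsimp only; have := hWge κ; omega
      · dsimp only; split_ifs <;> omega
      · rw [e]; exact hsrc κ
    have base1 : ∀ lam, (lam = q.μ ∨ lam = q.ν) → y = iterBlockOf k (z.shift lam) → ∃ p : Fin P.d → ℕ, (∀ κ, p κ ≤ W κ) ∧ (∀ κ, P.L ^ k / 2 ≤ p κ) ∧
        (∀ κ, p κ ≤ P.L ^ k / 2 + (if κ = q.μ ∨ κ = q.ν then P.L ^ k else 0)) ∧ ∀ κ, toFine k y κ = s κ + ((p κ : ℕ) : ZMod (P.sitesPerDir 0)) := by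
      intro lam hlam e
      rcases hshift lam hlam with h0 | ⟨h1, hstr⟩
      · exact base0 (e.trans h0)
      · refine ⟨fun κ => P.L ^ k / 2 + (if κ = lam then P.L ^ k else 0), fun κ => ?_, fun κ => ?_, fun κ => ?_, fun κ => ?_⟩
        · dsimp only
          by_cases hκ : κ = lam
          · subst hκ
            have : W κ = 2 * P.L ^ k - 1 := by simp only [hW]; rw [if_pos ⟨hlam, hstr⟩]
            rw [if_pos rfl, this]; omega
          · rw [if_neg hκ]; have := hWge κ; omega
        · dsimp only; omega
        · dsimp only
          by_cases hκ : κ = lam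
          · subst hκ; rw [if_pos rfl, if_pos hlam]
          · rw [if_neg hκ]; omega
        · rw [e, h1]; exact htgt lam κ
    rcases hy with e | e | e
    · exact base0 e
    · exact base1 q.μ (Or.inl rfl) e
    · exact base1 q.ν (Or.inr rfl) e
  obtain ⟨p, hpW, hph, hpu, hyp⟩ := hbase
  -- the bond: `x_κ = s_κ + a_κ`, `(x + e_dir)_κ = s_κ + a′_κ`, all offsets in the window, `|a_κ − p_κ|, |a′_κ − p_κ| ≤ ⌊L^k∕2⌋ + [κ ∈ {μ,ν}]·L^k`
  obtain ⟨x, dir⟩ := b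
  have hbond : ∃ a a' : Fin P.d → ℕ, (∀ κ, a κ ≤ W κ) ∧ (∀ κ, a' κ ≤ W κ) ∧ (∀ κ, x κ = s κ + ((a κ : ℕ) : ZMod (P.sitesPerDir 0))) ∧
      (∀ κ, (a' κ : ℤ) = a κ + (if κ = dir then 1 else 0)) ∧ (∀ κ, a κ ≤ P.L ^ k - 1 + (if κ = q.μ ∨ κ = q.ν then 1 else 0)) ∧
      (∀ κ, a' κ ≤ P.L ^ k - 1 + (if κ = q.μ ∨ κ = q.ν then 1 else 0)) := by
    -- generic: offsets `r_κ + l_κ`, `l_κ ≤ 1`, `l_κ = 1` only for plaquette directions, bumped by the straddle rule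
    have hoff : ∀ (l : Fin P.d → ℕ), (∀ κ, l κ ≤ 1) → (∀ κ, l κ = 1 → (κ = q.μ ∨ κ = q.ν)) → ∀ κ, r κ + l κ ≤ W κ ∧ r κ + l κ ≤ P.L ^ k - 1 + (if κ = q.μ ∨ κ = q.ν then 1 else 0) := by
      intro l hl1 hlq κ
      have hrκ := hrlt κ
      rcases Nat.le_one_iff_eq_zero_or_eq_one.mp (hl1 κ) with h0 | h1
      · rw [h0, add_zero]; have := hWge κ; constructor <;> [omega; (split_ifs <;> omega)]
      · have hq' := hlq κ h1
        rw [h1, if_pos hq']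
        refine ⟨?_, by omega⟩
        simp only [hW]
        by_cases hstr : r κ = P.L ^ k - 1
        · rw [if_pos ⟨hq', hstr⟩]; omega
        · rw [if_neg (fun h => hstr h.2)]; omega
    -- indicator letters
    have hind : ∀ lam : Fin P.d, (lam = q.μ ∨ lam = q.ν) →
        (∀ κ, (if κ = lam then 1 else 0 : ℕ) ≤ 1) ∧ (∀ κ, (if κ = lam then 1 else 0 : ℕ) = 1 → (κ = q.μ ∨ κ = q.ν)) := by
      intro lam hlam
      refine ⟨fun κ => by split_ifs <;> omega, fun κ h => ?_⟩
      by_cases hκ : κ = lam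
      · rw [hκ]; exact hlam
      · rw [if_neg hκ] at h; omega
    have hind2 : (∀ κ, ((if κ = q.μ then 1 else 0 : ℕ) + (if κ = q.ν then 1 else 0 : ℕ)) ≤ 1) ∧
        (∀ κ, ((if κ = q.μ then 1 else 0 : ℕ) + (if κ = q.ν then 1 else 0 : ℕ)) = 1 → (κ = q.μ ∨ κ = q.ν)) := by
      refine ⟨fun κ => ?_, fun κ h => ?_⟩
      · by_cases h1 : κ = q.μ
        · have h2 : κ ≠ q.ν := fun h2 => hμν (h1.symm.trans h2)
          rw [if_pos h1, if_neg h2]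
        · rw [if_neg h1]; split_ifs <;> omega
      · by_cases h1 : κ = q.μ
        · exact Or.inl h1
        · by_cases h2 : κ = q.ν
          · exact Or.inr h2
          · rw [if_neg h1, if_neg h2] at h; omega
    have hzero : (∀ _κ : Fin P.d, (0 : ℕ) ≤ 1) ∧ (∀ κ : Fin P.d, (0 : ℕ) = 1 → (κ = q.μ ∨ κ = q.ν)) := ⟨fun _ => by omega, fun _ h => by omega⟩
    rcases hb with e | e | e | e <;> simp only [PBond.mk.injEq] at e <;> obtain ⟨rfl, rfl⟩ := e
    · -- `(z, μ)`: `a = r`, `a′ = r + [κ = μ]`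
      obtain ⟨hl1, hl2⟩ := hind q.μ (Or.inl rfl)
      refine ⟨fun κ => r κ + 0, fun κ => r κ + (if κ = q.μ then 1 else 0), fun κ => (hoff (fun _ => 0) hzero.1 hzero.2 κ).1, fun κ => (hoff _ hl1 hl2 κ).1,
        fun κ => ?_, fun κ => ?_, fun κ => (hoff (fun _ => 0) hzero.1 hzero.2 κ).2, fun κ => (hoff _ hl1 hl2 κ).2⟩
      · simpa [hs, hr, hc0] using apply_eq_blockStart_add_mod hk z q.μ κ
      · push_cast; ring
    · -- `(z + e_μ, ν)`: `a = r + [κ = μ]`, `a′ = a + [κ = ν]`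
      obtain ⟨hl1, hl2⟩ := hind q.μ (Or.inl rfl)
      refine ⟨fun κ => r κ + (if κ = q.μ then 1 else 0), fun κ => r κ + ((if κ = q.μ then 1 else 0) + (if κ = q.ν then 1 else 0)), fun κ => (hoff _ hl1 hl2 κ).1,
        fun κ => (hoff _ hind2.1 hind2.2 κ).1, fun κ => ?_, fun κ => ?_, fun κ => (hoff _ hl1 hl2 κ).2, fun κ => (hoff _ hind2.1 hind2.2 κ).2⟩
      · simpa [hs, hr, hc0] using shift_apply_eq_blockStart_add hk z q.μ q.μ κ
      · push_cast; ring
    · -- `(z + e_ν, μ)`: `a = r + [κ = ν]`, `a′ = a + [κ = μ]`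
      obtain ⟨hl1, hl2⟩ := hind q.ν (Or.inr rfl)
      refine ⟨fun κ => r κ + (if κ = q.ν then 1 else 0), fun κ => r κ + ((if κ = q.μ then 1 else 0) + (if κ = q.ν then 1 else 0)), fun κ => (hoff _ hl1 hl2 κ).1,
        fun κ => (hoff _ hind2.1 hind2.2 κ).1, fun κ => ?_, fun κ => ?_, fun κ => (hoff _ hl1 hl2 κ).2, fun κ => (hoff _ hind2.1 hind2.2 κ).2⟩
      · simpa [hs, hr, hc0] using shift_apply_eq_blockStart_add hk z q.μ q.ν κ
      · push_cast; ring
    · -- `(z, ν)`: `a = r`, `a′ = r + [κ = ν]`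
      obtain ⟨hl1, hl2⟩ := hind q.ν (Or.inr rfl)
      refine ⟨fun κ => r κ + 0, fun κ => r κ + (if κ = q.ν then 1 else 0), fun κ => (hoff (fun _ => 0) hzero.1 hzero.2 κ).1, fun κ => (hoff _ hl1 hl2 κ).1,
        fun κ => ?_, fun κ => ?_, fun κ => (hoff (fun _ => 0) hzero.1 hzero.2 κ).2, fun κ => (hoff _ hl1 hl2 κ).2⟩
      · simpa [hs, hr, hc0] using apply_eq_blockStart_add_mod hk z q.μ κ
      · push_cast; ring
  obtain ⟨a, a', haW, ha'W, hxa, ha', hau, ha'u⟩ := hbond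
  -- the relative position and the fan
  have hN2 : ∀ κ, 2 * W κ < P.sitesPerDir 0 := fun κ => (window_lt_sitesPerDir hk hN4 (W κ) (hWle κ)).1
  have hrel : ∀ κ, rel (toFine k y) x κ = (a κ : ℤ) - p κ := fun κ => by
    rw [rel_apply]; exact rel_eq_of_window (hyp κ) (hxa κ) (hpW κ) (haW κ) (hN2 κ)
  have hrel' : ∀ κ, (rel (toFine k y) x + e dir) κ = (a' κ : ℤ) - p κ := fun κ => by
    rw [Pi.add_apply, hrel κ, e_apply, ha' κ]; split_ifs <;> ring
  have hwrap : (rel (toFine k y) x dir + 1) * 2 ≤ (P.sitesPerDir 0 : ℤ) := by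
    rw [hrel dir]
    have := (window_lt_sitesPerDir hk hN4 (W dir) (hWle dir)).2
    have := haW dir
    nlinarith
  have hfan : ∀ (κ : Fin P.d) (t : ℤ), min 0 (min (rel (toFine k y) x κ) ((rel (toFine k y) x + e dir) κ)) ≤ t →
      t ≤ max 0 (max (rel (toFine k y) x κ) ((rel (toFine k y) x + e dir) κ)) → (toFine k y) κ + ((t : ℤ) : ZMod (P.sitesPerDir 0)) ∈ I κ := by
    intro κ t ht1 ht2
    rw [hrel κ, hrel' κ] at ht1 ht2
    obtain ⟨u, hu, e⟩ := fan_mem_window (s κ) (hpW κ) (haW κ) (ha'W κ) t ht1 ht2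
    refine ⟨u, hu, ?_⟩
    rw [hyp κ, e]
  -- the number of bonds of the comb
  have hl1 : l1 (rel (toFine k y) x) ≤ P.d * (P.L ^ k / 2) + 2 * P.L ^ k := by
    unfold l1
    have hb : ∀ κ, (rel (toFine k y) x κ).natAbs ≤ P.L ^ k / 2 + (if κ = q.μ ∨ κ = q.ν then P.L ^ k else 0) := fun κ => by
      rw [hrel κ]
      have h1 := hph κ; have h2 := hpu κ; have h3 := hau κ
      split_ifs at h2 h3 ⊢ <;> omega
    calc ∑ κ, (rel (toFine k y) x κ).natAbs ≤ ∑ κ : Fin P.d, (P.L ^ k / 2 + (if κ = q.μ ∨ κ = q.ν then P.L ^ k else 0)) := Finset.sum_le_sum fun κ _ => hb κ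
      _ = P.d * (P.L ^ k / 2) + 2 * P.L ^ k := by
          rw [Finset.sum_add_distrib, Finset.sum_const, Finset.card_univ, Fintype.card_fin, smul_eq_mul, Finset.sum_ite, Finset.sum_const_zero, add_zero,
            Finset.sum_const, smul_eq_mul]
          congr 1
          have : (Finset.univ.filter fun κ : Fin P.d => κ = q.μ ∨ κ = q.ν) = {q.μ, q.ν} := by
            ext κ; simp
          rw [this, Finset.card_pair hμν]
  -- the comb-fan Stokes bound
  have h := dist1_gaugeActT_axialT_le_of_box U (I := I) hδ hWin (toFine k y) x dir hwrap hfan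
  rw [← dist1_SU_eq, ← gaugeActT_eq_gaugeAct]
  exact h.trans (mul_le_mul_of_nonneg_right (by exact_mod_cast hl1) hδ)

end Flat

end Summit.QuantumFields.YangMills.Theorems.TubeStart

end
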